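import Summits.QuantumFields.BalabanUV.T4Continuum.Support.ShellMeasureWilsonTrace
import Summits.QuantumFields.BalabanUV.T4Continuum.Support.ShellMeasureExpLipschitz

/-!
# `T4Continuum.ShellMeasureWilsonMoving` — the trace bound for sectioned words with MOVING (analytic) letters: the
# Wilson part of (S-ii) AT ANY LEVEL from (AN-bound), quadratic in the small quantities
# (cell `pub-balaban`, sub-cell `t4`, spine estimate NE7c (node U5b); lineage t4-ne7c-p1 = PROVER seat P1
# «shell-measure route», generation 25; companion of `ShellMeasureWilson{Words,Trace,Block,Toy}` and
# `ShellMeasureInterpAnalytic`; ADDITIVE — imports `ShellMeasureWilsonTrace` + `ShellMeasureExpLipschitz` only)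

HONEST FRAMING.  Finite four-torus programme, rung (B)+1 only — NOT infinite volume, NOT a mass gap, NOT the Clay
problem, NOT summit progress; (B), `BetaPertHyp`, (B^μ) not consumed.  (M1) for Bałaban's inductively defined measures
is NOT PRINTED (GAPS G-ne7cp1-1) and NOT moved.  [folklore] kernel bookkeeping on the INPUT LIST of the smooth member at
the live levels (GAPS G-ne7cp1-22, G-ne7cp1-26): 0 sorry, 0 citations, nothing of the audited series asserted.  HONEST
DEPENDENCY (cell): continuum YM on T⁴ ⇐ BetaPertH ∧ nine spine estimates (0/9 proved); BetaPertH ⇐ (D1) ∧ (D4) ∧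
CAP+tail; G-an2-4 gates asym, D1 and NE2/3/4.

THE POINT.  `ShellMeasureWilsonTrace.abs_trace_sub_le` bounds `|τ(G_w(1) − G_w(c))|` for words whose generators move
LINEARLY along the contraction (`exp(cY)` — level 0).  At a live level `j ≥ 1` the bond variables of the localized
minimiser along the block contraction are ANALYTIC, not linear, functions `c ↦ X_b(c)` of the contraction parameter
(B11 Prop. 9 TYPE), skew-Hermitian for real `c`, with `X_b` at `c` and at `1` NOT commuting.  This file proves the same
QUADRATIC trace bound for such MOVING letters (`MLetter.moving X`, read as `exp(X c)`):
  `|τ(G_w(1) − G_w(c))| ≤ (1−c)·N·L(w)·(d(w) + 4 s(w))`     (`abs_trace_sub_le_moving`),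
where `L(w) = Σ_moving L_i` collects LIPSCHITZ constants `‖X_i 1 − X_i c‖ ≤ (1−c)L_i`, `s(w) = Σ_moving t_i ≤ 1` the
sizes `‖X_i c‖ ≤ t_i`, `d(w) = Σ_frozen ‖a − 1‖`.  MECHANISM: no splitting `exp X(1) = exp(X(1) − X(c))·exp X(c)` is
available (non-commuting); instead `exp X₁ − exp X_c = (X₁ − X_c) + (T(X₁) − T(X_c))`, `T(x) = exp x − 1 − x`, with
the SECOND-ORDER LIPSCHITZ BOUND `‖T(a) − T(b)‖ ≤ (e^t − 1)·‖a − b‖` of `ShellMeasureExpLipschitz` (`t ≥ ‖a‖, ‖b‖`;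
termwise, non-commutative), and the first-order term `τ((X₁ − X_c)·W) = τ((X₁ − X_c)(W − 1))`
because `τ(X₁) = τ(X_c) = 0`.  At level 0 (`X(c) = cY`, `L = t = ‖Y‖`) this is `abs_trace_sub_le` again.
(§2) THE LIPSCHITZ CONSTANT FROM (AN-bound): if `X(c) = 𝓧(c·z₀)` with `𝓧 : ℂ → A` complex differentiable and
`‖𝓧‖ ≤ a` on `‖w‖ < R`, `z₀ ≤ x₀ < R`, then `‖X 1 − X c‖ ≤ (1−c)·3a·x₀/(R − x₀)` (the lineage's
`T4ShellMeasureAnalytic.cauchy_bounds_on_segment` + the mean-value inequality) — so the Wilson part of (S-ii)_j is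
of printed TYPE (AN-bound)_j, exactly like (S-i)_j (`ShellMeasureInterpAnalytic`); the non-Wilson terms `𝐄_j/𝐑_j/𝐁_j`
of `A_j` (B14 (2.23)) keep the Cauchy form of `ShellMeasureHeadlines` §2 (B12 Thm 1 TYPE).  Nothing instantiated.

WHAT THIS DOES NOT DO.  No instance of (AN-bound) at any `j ≥ 1`; (LR), (MR), (W1), (F∞)-rate unchanged; NE7c NOT
proved; 0/9 spine.
-/

noncomputable section

open NormedSpace Set Metric

namespace Summit.QuantumFields.BalabanUV.T4Continuum.ShellMeasureWilsonMoving

open Literature.MathematicalPhysics.QuantumFieldTheory.Balaban1983to89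
open T4ShellMeasurePlaquette (norm_exp_sub_one_le)
open T4ShellMeasureAnalytic (cauchy_bounds_on_segment)
open ShellMeasureWilsonWords (exp_sub_one_le_pair)
open ShellMeasureWilsonTrace (TraceData norm_mul_sub_one_le)
open ShellMeasureExpLipschitz (norm_expTail_sub_expTail_le)

/-! ## §1 Moving letters and the trace bound -/

section Moving

variable {A : Type*} [NormedRing A] [NormedAlgebra ℂ A] [CompleteSpace A] [NormOneClass A]

/-- a letter of a sectioned word at a live level: a FROZEN factor `a`, or a MOVING generator `X : ℝ → A` read as the
factor `exp(X c)` at contraction parameter `c` (the minimiser's bond variable along the contraction). [folklore] -/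
inductive MLetter (A : Type*) where
  | frozen (a : A) : MLetter A
  | moving (X : ℝ → A) : MLetter A

namespace MLetter

/-- the factor at contraction `c`. [folklore] -/
def eval (c : ℝ) : MLetter A → A
  | frozen a => a
  | moving X => exp (X c)

/-- ADMISSIBILITY with size `t` and Lipschitz constant `L` along `[0,1]`: frozen — `‖a‖ ≤ 1` (and `t = L = 0` is
allowed); moving — for all `0 ≤ c ≤ 1`: `τ(X c) = 0`, `‖exp(X c)‖ ≤ 1`, `‖X c‖ ≤ t`, `‖X 1 − X c‖ ≤ (1−c)·L`.
[folklore] -/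
def Good (τ : A → ℝ) (t L : ℝ) : MLetter A → Prop
  | frozen a => ‖a‖ ≤ 1 ∧ 0 ≤ t ∧ 0 ≤ L
  | moving X => 0 ≤ t ∧ 0 ≤ L ∧ ∀ c : ℝ, 0 ≤ c → c ≤ 1 →
      τ (X c) = 0 ∧ ‖exp (X c)‖ ≤ 1 ∧ ‖X c‖ ≤ t ∧ ‖X 1 - X c‖ ≤ (1 - c) * L

/-- the frozen deviation `‖a − 1‖`, resp. `0`. [folklore] -/
def dev : MLetter A → ℝ
  | frozen a => ‖a - 1‖
  | moving _ => 0

omit [NormedAlgebra ℂ A] [CompleteSpace A] [NormOneClass A] in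
/-- `dev ≥ 0`. [folklore] -/
theorem dev_nonneg (ℓ : MLetter A) : 0 ≤ ℓ.dev := by
  cases ℓ with | frozen a => exact norm_nonneg _ | moving X => exact le_rfl

omit [NormedAlgebra ℂ A] [CompleteSpace A] [NormOneClass A] in
/-- sizes are non-negative. [folklore] -/
theorem Good.nonneg {τ : A → ℝ} {t L : ℝ} {ℓ : MLetter A} (h : ℓ.Good τ t L) : 0 ≤ t ∧ 0 ≤ L := by
  cases ℓ with | frozen a => exact ⟨h.2.1, h.2.2⟩ | moving X => exact ⟨h.1, h.2.1⟩

omit [NormedAlgebra ℂ A] [CompleteSpace A] [NormOneClass A] in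
/-- an admissible letter is a contraction. [folklore] -/
theorem norm_eval_le_one {τ : A → ℝ} {t L : ℝ} {ℓ : MLetter A} (h : ℓ.Good τ t L) {c : ℝ} (hc0 : 0 ≤ c)
    (hc1 : c ≤ 1) : ‖ℓ.eval c‖ ≤ 1 := by
  cases ℓ with | frozen a => exact h.1 | moving X => exact (h.2.2 c hc0 hc1).2.1

omit [NormOneClass A] in
/-- deviation of an admissible letter from `1`: `≤ dev + 3t` (`t ≤ 1`). [folklore] -/
theorem norm_eval_sub_one_le {τ : A → ℝ} {t L : ℝ} {ℓ : MLetter A} (h : ℓ.Good τ t L) (ht1 : t ≤ 1) {c : ℝ}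
    (hc0 : 0 ≤ c) (hc1 : c ≤ 1) : ‖ℓ.eval c - 1‖ ≤ ℓ.dev + 3 * t := by
  cases ℓ with
  | frozen a => have := h.2.1; simp only [eval, dev]; linarith
  | moving X =>
    obtain ⟨ht0, -, hX⟩ := h
    obtain ⟨-, -, hn, -⟩ := hX c hc0 hc1
    simp only [eval, dev, zero_add]
    have h1 := norm_exp_sub_one_le (X c)
    have h2 := (exp_sub_one_le_pair (norm_nonneg (X c))).2 (hn.trans ht1)
    linarith

end MLetter

open MLetter

/-- the word at contraction `c`. [folklore] -/
def mwordEval (c : ℝ) (w : List (MLetter A)) : A := (w.map (MLetter.eval c)).prod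

/-- `Σ dev`. [folklore] -/
def mdFro (w : List (MLetter A)) : ℝ := (w.map MLetter.dev).sum

omit [NormedAlgebra ℂ A] [CompleteSpace A] [NormOneClass A] in
/-- the empty word is `1`. [folklore] -/
@[simp] theorem mwordEval_nil (c : ℝ) : mwordEval c ([] : List (MLetter A)) = 1 := by simp [mwordEval]

omit [NormedAlgebra ℂ A] [CompleteSpace A] [NormOneClass A] in
/-- `G_{ℓ::w}(c) = eval_c ℓ · G_w(c)`. [folklore] -/
@[simp] theorem mwordEval_cons (c : ℝ) (ℓ : MLetter A) (w : List (MLetter A)) :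
    mwordEval c (ℓ :: w) = ℓ.eval c * mwordEval c w := by simp [mwordEval]

omit [NormedAlgebra ℂ A] [CompleteSpace A] [NormOneClass A] in
/-- `d([]) = 0`. [folklore] -/
@[simp] theorem mdFro_nil : mdFro ([] : List (MLetter A)) = 0 := by simp [mdFro]

omit [NormedAlgebra ℂ A] [CompleteSpace A] [NormOneClass A] in
/-- `d(ℓ::w) = dev ℓ + d(w)`. [folklore] -/
@[simp] theorem mdFro_cons (ℓ : MLetter A) (w : List (MLetter A)) : mdFro (ℓ :: w) = ℓ.dev + mdFro w := by
  simp [mdFro]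

omit [NormedAlgebra ℂ A] [CompleteSpace A] [NormOneClass A] in
/-- `d(w) ≥ 0`. [folklore] -/
theorem mdFro_nonneg (w : List (MLetter A)) : 0 ≤ mdFro w :=
  List.sum_nonneg (by intro x hx; obtain ⟨ℓ, -, rfl⟩ := List.mem_map.1 hx; exact ℓ.dev_nonneg)

/-- A GRADED WORD: letters with their sizes `t_i` and Lipschitz constants `L_i`; `s = Σ t_i`, `L = Σ L_i`. We carry the
data as a list of triples. [folklore] -/
def sSum (w : List (MLetter A × ℝ × ℝ)) : ℝ := (w.map fun x => x.2.1).sum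

/-- `L = Σ L_i`. [folklore] -/
def lSum (w : List (MLetter A × ℝ × ℝ)) : ℝ := (w.map fun x => x.2.2).sum

omit [NormedRing A] [NormedAlgebra ℂ A] [CompleteSpace A] [NormOneClass A] in
/-- `s([]) = 0`. [folklore] -/
@[simp] theorem sSum_nil : sSum ([] : List (MLetter A × ℝ × ℝ)) = 0 := by simp [sSum]
omit [NormedRing A] [NormedAlgebra ℂ A] [CompleteSpace A] [NormOneClass A] in
/-- `s(x::w) = t_x + s(w)`. [folklore] -/
@[simp] theorem sSum_cons (x : MLetter A × ℝ × ℝ) (w : List (MLetter A × ℝ × ℝ)) :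
    sSum (x :: w) = x.2.1 + sSum w := by simp [sSum]
omit [NormedRing A] [NormedAlgebra ℂ A] [CompleteSpace A] [NormOneClass A] in
/-- `L([]) = 0`. [folklore] -/
@[simp] theorem lSum_nil : lSum ([] : List (MLetter A × ℝ × ℝ)) = 0 := by simp [lSum]
omit [NormedRing A] [NormedAlgebra ℂ A] [CompleteSpace A] [NormOneClass A] in
/-- `L(x::w) = L_x + L(w)`. [folklore] -/
@[simp] theorem lSum_cons (x : MLetter A × ℝ × ℝ) (w : List (MLetter A × ℝ × ℝ)) :
    lSum (x :: w) = x.2.2 + lSum w := by simp [lSum]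

omit [NormedAlgebra ℂ A] [CompleteSpace A] [NormOneClass A] in
/-- graded admissible words have non-negative `s`, `L`. [folklore] -/
theorem sSum_lSum_nonneg {τ : A → ℝ} :
    ∀ {w : List (MLetter A × ℝ × ℝ)}, (∀ x ∈ w, x.1.Good τ x.2.1 x.2.2) → 0 ≤ sSum w ∧ 0 ≤ lSum w
  | [], _ => by simp
  | x :: w, hw => by
    have hx := (hw x (by simp)).nonneg
    have ih := sSum_lSum_nonneg (w := w) fun y hy => hw y (List.mem_cons_of_mem _ hy)
    simp only [sSum_cons, lSum_cons]
    exact ⟨add_nonneg hx.1 ih.1, add_nonneg hx.2 ih.2⟩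

omit [NormedAlgebra ℂ A] [CompleteSpace A] in
/-- an admissible word is a contraction. [folklore] -/
theorem norm_mwordEval_le_one {τ : A → ℝ} :
    ∀ {w : List (MLetter A × ℝ × ℝ)}, (∀ x ∈ w, x.1.Good τ x.2.1 x.2.2) →
      ∀ {c : ℝ}, 0 ≤ c → c ≤ 1 → ‖mwordEval c (w.map Prod.fst)‖ ≤ 1
  | [], _, _, _, _ => by simp
  | x :: w, hw, c, hc0, hc1 => by
    rw [List.map_cons, mwordEval_cons]
    have h1 := norm_eval_le_one (hw x (by simp)) hc0 hc1
    have h2 := norm_mwordEval_le_one (fun y hy => hw y (List.mem_cons_of_mem _ hy)) hc0 hc1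
    calc ‖x.1.eval c * mwordEval c (w.map Prod.fst)‖ ≤ ‖x.1.eval c‖ * ‖mwordEval c (w.map Prod.fst)‖ := norm_mul_le _ _
      _ ≤ 1 * 1 := mul_le_mul h1 h2 (norm_nonneg _) zero_le_one
      _ = 1 := one_mul _

omit [NormOneClass A] in
/-- deviation of an admissible word from `1`: `≤ d(w) + 3 s(w)` (`s(w) ≤ 1`). [folklore] -/
theorem norm_mwordEval_sub_one_le {τ : A → ℝ} :
    ∀ {w : List (MLetter A × ℝ × ℝ)}, (∀ x ∈ w, x.1.Good τ x.2.1 x.2.2) → sSum w ≤ 1 →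
      ∀ {c : ℝ}, 0 ≤ c → c ≤ 1 → ‖mwordEval c (w.map Prod.fst) - 1‖ ≤ mdFro (w.map Prod.fst) + 3 * sSum w
  | [], _, _, _, _, _ => by simp
  | x :: w, hw, hs, c, hc0, hc1 => by
    rw [sSum_cons] at hs
    have hw' : ∀ y ∈ w, y.1.Good τ y.2.1 y.2.2 := fun y hy => hw y (List.mem_cons_of_mem _ hy)
    have hσ0 := (sSum_lSum_nonneg hw').1
    have hx0 := (hw x (by simp)).nonneg
    rw [List.map_cons, mwordEval_cons, sSum_cons, mdFro_cons]
    have h1 := norm_eval_sub_one_le (hw x (by simp)) (by linarith) hc0 hc1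
    have h2 := norm_mwordEval_sub_one_le hw' (by linarith) hc0 hc1
    have h3 := norm_mul_sub_one_le (g₂ := mwordEval c (w.map Prod.fst)) (norm_eval_le_one (hw x (by simp)) hc0 hc1)
    linarith

/-- THE MOVING-LETTER STEP: for an admissible moving letter `X` (size `t ≤ 1`, Lipschitz `L`), contractions `Gc, P, S`
with `‖Gc·(S·P) − 1‖ ≤ D`, `0 ≤ c ≤ 1`:
`|τ(P·((exp(X 1) − exp(X c))·Gc)·S)| ≤ (1−c)·N·L·(D + 3t)` — first order `τ((X₁ − X_c)(W − 1))` (`τ X = 0`), second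
order by `norm_expTail_sub_expTail_le`. [folklore] -/
theorem abs_trace_movingStep_le (T : TraceData A) {X : ℝ → A} {t L : ℝ} (hX : (MLetter.moving X).Good T.τ t L)
    (ht1 : t ≤ 1) {c : ℝ} (hc0 : 0 ≤ c) (hc1 : c ≤ 1) {Gc P S : A} (hGc : ‖Gc‖ ≤ 1) (hP : ‖P‖ ≤ 1) (hS : ‖S‖ ≤ 1)
    {D : ℝ} (hGSP : ‖Gc * (S * P) - 1‖ ≤ D) :
    |T.τ (P * ((exp (X 1) - exp (X c)) * Gc) * S)| ≤ (1 - c) * T.N * L * (D + 3 * t) := by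
  have hN0 := T.N_nonneg
  have h1c : 0 ≤ 1 - c := by linarith
  obtain ⟨ht0, hL0, hXc⟩ := hX
  obtain ⟨hτ1, -, hn1, -⟩ := hXc 1 zero_le_one le_rfl
  obtain ⟨hτc, -, hnc, hLip⟩ := hXc c hc0 hc1
  -- move `P` to the back
  set W := Gc * S * P with hW
  have hcyc : T.τ (P * ((exp (X 1) - exp (X c)) * Gc) * S) = T.τ ((exp (X 1) - exp (X c)) * W) := by
    rw [mul_assoc P, T.comm P, hW]; congr 1; noncomm_ring
  have hWn : ‖W‖ ≤ 1 := by
    rw [hW]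
    calc ‖Gc * S * P‖ ≤ ‖Gc * S‖ * ‖P‖ := norm_mul_le _ _
      _ ≤ (‖Gc‖ * ‖S‖) * ‖P‖ := by gcongr; exact norm_mul_le _ _
      _ ≤ (1 * 1) * 1 := by gcongr
      _ = 1 := by norm_num
  have hW1 : ‖W - 1‖ ≤ D := by rw [hW, mul_assoc]; exact hGSP
  have hD0 : 0 ≤ D := (norm_nonneg _).trans hW1
  -- decomposition
  have hdec : (exp (X 1) - exp (X c)) * W =
      (X 1 - X c) * (W - 1) + (X 1 - X c) + ((exp (X 1) - 1 - X 1) - (exp (X c) - 1 - X c)) * W := by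
    noncomm_ring
  rw [hcyc, hdec, T.map_add, T.map_add, T.map_sub (X 1), hτ1, hτc, sub_zero, add_zero]
  have hb1 : |T.τ ((X 1 - X c) * (W - 1))| ≤ T.N * ((1 - c) * L * D) := by
    refine (T.abs_le _).trans (mul_le_mul_of_nonneg_left ?_ hN0)
    exact (norm_mul_le _ _).trans (mul_le_mul hLip hW1 (norm_nonneg _) (by positivity))
  have hb2 : |T.τ (((exp (X 1) - 1 - X 1) - (exp (X c) - 1 - X c)) * W)| ≤ T.N * ((1 - c) * L * (3 * t)) := by
    refine (T.abs_le _).trans (mul_le_mul_of_nonneg_left ?_ hN0)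
    have h2 := norm_expTail_sub_expTail_le hn1 hnc
    have het : Real.exp t - 1 ≤ 3 * t := (exp_sub_one_le_pair ht0).2 ht1
    calc ‖((exp (X 1) - 1 - X 1) - (exp (X c) - 1 - X c)) * W‖
        ≤ ‖(exp (X 1) - 1 - X 1) - (exp (X c) - 1 - X c)‖ * ‖W‖ := norm_mul_le _ _
      _ ≤ ((Real.exp t - 1) * ‖X 1 - X c‖) * 1 := mul_le_mul h2 hWn (norm_nonneg _) (by
            exact mul_nonneg (by linarith [Real.add_one_le_exp t]) (norm_nonneg _))
      _ ≤ (3 * t) * ((1 - c) * L) := by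
          rw [mul_one]; exact mul_le_mul het hLip (norm_nonneg _) (by positivity)
      _ = (1 - c) * L * (3 * t) := by ring
  calc |T.τ ((X 1 - X c) * (W - 1)) + T.τ (((exp (X 1) - 1 - X 1) - (exp (X c) - 1 - X c)) * W)|
      ≤ |T.τ ((X 1 - X c) * (W - 1))| + |T.τ (((exp (X 1) - 1 - X 1) - (exp (X c) - 1 - X c)) * W)| := abs_add_le _ _
    _ ≤ T.N * ((1 - c) * L * D) + T.N * ((1 - c) * L * (3 * t)) := add_le_add hb1 hb2
    _ = (1 - c) * T.N * L * (D + 3 * t) := by ring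

/-- **THE TRACE INVARIANT FOR MOVING LETTERS** (two-sided, induction on the graded word): admissible letters,
`s(w) ≤ 1`, `0 ≤ c ≤ 1`, contractions `P, S`:
`|τ(P·(G_w(1) − G_w(c))·S)| ≤ (1−c)·N·L(w)·(d(w) + ‖SP − 1‖ + 4 s(w))`. [folklore] -/
theorem abs_trace_conj_sub_le_moving (T : TraceData A) {w : List (MLetter A × ℝ × ℝ)}
    (hw : ∀ x ∈ w, x.1.Good T.τ x.2.1 x.2.2) (hs : sSum w ≤ 1) {c : ℝ} (hc0 : 0 ≤ c) (hc1 : c ≤ 1) :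
    ∀ (P S : A), ‖P‖ ≤ 1 → ‖S‖ ≤ 1 →
      |T.τ (P * (mwordEval 1 (w.map Prod.fst) - mwordEval c (w.map Prod.fst)) * S)| ≤
        (1 - c) * T.N * lSum w * (mdFro (w.map Prod.fst) + ‖S * P - 1‖ + 4 * sSum w) := by
  have hN0 := T.N_nonneg
  have h1c : 0 ≤ 1 - c := by linarith
  induction w with
  | nil => intro P S _ _; simp [T.map_zero]
  | cons x w ih =>
    intro P S hP hS
    have hw' : ∀ y ∈ w, y.1.Good T.τ y.2.1 y.2.2 := fun y hy => hw y (List.mem_cons_of_mem _ hy)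
    have hx : x.1.Good T.τ x.2.1 x.2.2 := hw x (by simp)
    rw [sSum_cons] at hs
    obtain ⟨hσ0, hL0⟩ := sSum_lSum_nonneg hw'
    obtain ⟨ht0, hl0⟩ := hx.nonneg
    have hd0 := mdFro_nonneg (w.map Prod.fst)
    have hσ1 : sSum w ≤ 1 := by linarith
    replace ih := ih hw' hσ1
    rw [List.map_cons, mwordEval_cons, mwordEval_cons, sSum_cons, lSum_cons, mdFro_cons]
    have hg₁n : ‖x.1.eval 1‖ ≤ 1 := norm_eval_le_one hx zero_le_one le_rfl
    have hGcn : ‖mwordEval c (w.map Prod.fst)‖ ≤ 1 := norm_mwordEval_le_one hw' hc0 hc1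
    have hGc1 : ‖mwordEval c (w.map Prod.fst) - 1‖ ≤ mdFro (w.map Prod.fst) + 3 * sSum w :=
      norm_mwordEval_sub_one_le hw' hσ1 hc0 hc1
    have hg₁1 : ‖x.1.eval 1 - 1‖ ≤ x.1.dev + 3 * x.2.1 := norm_eval_sub_one_le hx (by linarith) zero_le_one le_rfl
    have hSP : ‖S * P‖ ≤ 1 := (norm_mul_le _ _).trans (by nlinarith [norm_nonneg S, norm_nonneg P])
    have split : P * (x.1.eval 1 * mwordEval 1 (w.map Prod.fst) - x.1.eval c * mwordEval c (w.map Prod.fst)) * S =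
        (P * x.1.eval 1) * (mwordEval 1 (w.map Prod.fst) - mwordEval c (w.map Prod.fst)) * S +
          P * ((x.1.eval 1 - x.1.eval c) * mwordEval c (w.map Prod.fst)) * S := by
      noncomm_ring
    rw [split, T.map_add]
    have hPg : ‖P * x.1.eval 1‖ ≤ 1 := (norm_mul_le _ _).trans (by nlinarith [norm_nonneg P, norm_nonneg (x.1.eval 1)])
    have hq' : ‖S * (P * x.1.eval 1) - 1‖ ≤ ‖S * P - 1‖ + (x.1.dev + 3 * x.2.1) := by
      rw [← mul_assoc]
      exact (norm_mul_sub_one_le hSP).trans (add_le_add le_rfl hg₁1)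
    have first : |T.τ (P * x.1.eval 1 * (mwordEval 1 (w.map Prod.fst) - mwordEval c (w.map Prod.fst)) * S)| ≤
        (1 - c) * T.N * lSum w * (mdFro (w.map Prod.fst) + (‖S * P - 1‖ + (x.1.dev + 3 * x.2.1)) + 4 * sSum w) := by
      refine (ih (P * x.1.eval 1) S hPg hS).trans ?_
      have hfac : 0 ≤ (1 - c) * T.N * lSum w := by positivity
      nlinarith [hq']
    obtain ⟨ℓ, t, L⟩ := x
    cases ℓ with
    | frozen a =>
      have hz : (MLetter.frozen a : MLetter A).eval 1 - (MLetter.frozen a).eval c = 0 := by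
        simp [MLetter.eval]
      rw [hz, zero_mul, mul_zero, zero_mul, T.map_zero, add_zero]
      simp only [MLetter.dev] at first ⊢
      refine first.trans ?_
      have hf : 0 ≤ (1 - c) * T.N := mul_nonneg h1c hN0
      simp only at ht0 hl0 hs
      nlinarith [mul_nonneg hf hl0, mul_nonneg hf hL0, mul_nonneg (mul_nonneg hf hL0) ht0,
        mul_nonneg (mul_nonneg hf hl0) (add_nonneg hd0 (norm_nonneg (S * P - 1))),
        mul_nonneg (mul_nonneg hf hl0) hσ0, mul_nonneg (mul_nonneg hf hl0) ht0,
        mul_nonneg (mul_nonneg hf hl0) (norm_nonneg (a - 1))]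
    | moving X =>
      simp only [MLetter.dev, zero_add] at first ⊢
      simp only at hs ht0 hl0 hx
      have hGSP : ‖mwordEval c (w.map Prod.fst) * (S * P) - 1‖ ≤ (mdFro (w.map Prod.fst) + 3 * sSum w) + ‖S * P - 1‖ :=
        (norm_mul_sub_one_le hGcn).trans (add_le_add hGc1 le_rfl)
      have second := abs_trace_movingStep_le T hx (by linarith) hc0 hc1 hGcn hP hS hGSP
      simp only [MLetter.eval] at second ⊢
      refine (abs_add_le _ _).trans ((add_le_add first second).trans ?_)
      have hf : 0 ≤ (1 - c) * T.N := mul_nonneg h1c hN0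
      nlinarith [mul_nonneg hf (mul_nonneg hl0 hσ0), mul_nonneg hf (mul_nonneg hL0 ht0),
        mul_nonneg hf (mul_nonneg hl0 ht0), mul_nonneg hf (mul_nonneg hL0 hσ0)]

/-- **THE TRACE BOUND FOR ONE SECTIONED WORD WITH MOVING LETTERS**:
`|τ(G_w(1) − G_w(c))| ≤ (1−c)·N·L(w)·(d(w) + 4 s(w))`. [folklore] -/
theorem abs_trace_sub_le_moving (T : TraceData A) {w : List (MLetter A × ℝ × ℝ)}
    (hw : ∀ x ∈ w, x.1.Good T.τ x.2.1 x.2.2) (hs : sSum w ≤ 1) {c : ℝ} (hc0 : 0 ≤ c) (hc1 : c ≤ 1) :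
    |T.τ (mwordEval 1 (w.map Prod.fst) - mwordEval c (w.map Prod.fst))| ≤
      (1 - c) * T.N * lSum w * (mdFro (w.map Prod.fst) + 4 * sSum w) := by
  have h := abs_trace_conj_sub_le_moving T hw hs hc0 hc1 1 1 (le_of_eq norm_one) (le_of_eq norm_one)
  simpa using h

end Moving

/-! ## §2 The Lipschitz constant and the size from an analyticity–boundedness pair -/

section Analytic

variable {A : Type*} [NormedRing A] [NormedAlgebra ℂ A] [CompleteSpace A]

/-- **THE MOVING-LETTER DATA FROM (AN-bound).**  If `𝓧 : ℂ → A` is complex differentiable with `‖𝓧‖ ≤ a` on `‖w‖ < R`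
and `0 < x₀ < R`, then along the contraction ray of a point `z₀ ∈ (0, x₀]` the letter `X c = 𝓧(c·z₀)` has size
`‖X c‖ ≤ a` and Lipschitz bound `‖X 1 − X c‖ ≤ (1−c)·(3a/(R − x₀))·x₀` for `0 ≤ c ≤ 1` (Cauchy + the mean-value
inequality). [folklore] -/
theorem movingData_of_differentiableOn_ball {𝓧 : ℂ → A} {R a x₀ : ℝ} (hx₀ : 0 < x₀) (hR : x₀ < R)
    (hf : DifferentiableOn ℂ 𝓧 (ball 0 R)) (ha : ∀ w ∈ ball (0 : ℂ) R, ‖𝓧 w‖ ≤ a) {z₀ : ℝ} (hz₀ : z₀ ∈ Ioc 0 x₀)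
    {c : ℝ} (hc0 : 0 ≤ c) (hc1 : c ≤ 1) :
    ‖𝓧 ((c * z₀ : ℝ) : ℂ)‖ ≤ a ∧ ‖𝓧 ((z₀ : ℝ) : ℂ) - 𝓧 ((c * z₀ : ℝ) : ℂ)‖ ≤ (1 - c) * (3 * a / (R - x₀) * x₀) := by
  have hcz : |c * z₀| ≤ x₀ := by
    rw [abs_of_nonneg (mul_nonneg hc0 hz₀.1.le)]; nlinarith [hz₀.2, hz₀.1]
  refine ⟨ha _ ?_, ?_⟩
  · rw [mem_ball_zero_iff, Complex.norm_real, Real.norm_eq_abs]; exact hcz.trans_lt hR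
  -- mean value inequality for t ↦ 𝓧(t z₀) on [c, 1]
  have hcs := cauchy_bounds_on_segment hx₀.le hR hf ha
  set φ : ℝ → A := fun t => 𝓧 ((t * z₀ : ℝ) : ℂ) with hφ
  have hderiv : ∀ t ∈ Icc c 1, HasDerivWithinAt φ (z₀ • deriv 𝓧 ((t * z₀ : ℝ) : ℂ)) (Icc c 1) t := by
    intro t ht
    have htz : |t * z₀| ≤ x₀ := by
      rw [abs_of_nonneg (mul_nonneg (hc0.trans ht.1) hz₀.1.le)]; nlinarith [hz₀.2, hz₀.1, ht.2]
    have h1 : HasDerivAt (fun y : ℝ => 𝓧 y) (deriv 𝓧 ((t * z₀ : ℝ) : ℂ)) (t * z₀) := (hcs _ htz).1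
    have h2 : HasDerivAt (fun t : ℝ => t * z₀) z₀ t := by simpa using (hasDerivAt_id t).mul_const z₀
    exact (h1.scomp t h2).hasDerivWithinAt
  have hbound : ∀ t ∈ Ico c 1, ‖z₀ • deriv 𝓧 ((t * z₀ : ℝ) : ℂ)‖ ≤ 3 * a / (R - x₀) * x₀ := by
    intro t ht
    have htz : |t * z₀| ≤ x₀ := by
      rw [abs_of_nonneg (mul_nonneg (hc0.trans ht.1) hz₀.1.le)]; nlinarith [hz₀.2, hz₀.1, ht.2.le]
    have hd := (hcs _ htz).2.2.1
    have ha0 : 0 ≤ a := (norm_nonneg _).trans (ha 0 (mem_ball_self (hx₀.trans hR)))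
    rw [norm_smul, Real.norm_of_nonneg hz₀.1.le]
    calc z₀ * ‖deriv 𝓧 ((t * z₀ : ℝ) : ℂ)‖ ≤ x₀ * (3 * a / (R - x₀)) :=
          mul_le_mul hz₀.2 hd (norm_nonneg _) hx₀.le
      _ = 3 * a / (R - x₀) * x₀ := by ring
  have hmv := norm_image_sub_le_of_norm_deriv_le_segment' hderiv hbound 1 (right_mem_Icc.2 hc1)
  simpa [hφ, mul_comm] using hmv

end Analytic

end Summit.QuantumFields.BalabanUV.T4Continuum.ShellMeasureWilsonMoving
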